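import Mathlib
import Literature.Probability.LatticeModels.GKSInequalities
import Summits.CriticalPhenomena.Ising3DConformalLimit.Theorems.PrecisionLaplacianInverseMFerromagnetImNonadjOfLaw2Aux
import Summits.CriticalPhenomena.Ising3DConformalLimit.Theorems.PrecisionLaplacianInverseMFerromagnetEntryNonposOfPcov
import HarnessLib

/-!
# Crux `PrecisionLaplacian.MoebiusLimitOfTwoPointLaw` (stmt-CriticalPhenomena-4801), line `Sketch` —
# auxiliary lemmas for stub `stub_imNonadj_of_amputatedLebowitz` (E1: VP¹ ⇒ IM at non-adjacent pairs)

THEOREM-ONLY helper file (no definitions), zero-field spin systems `gksExpect univ K C` on `Fin n`.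

* `e1_ham_decimate`, `e1_decimate`: **star–triangle decimation of ONE spin** `y` with local field
  `h_y`, `cosh h_y = e^{c} e^{J₀σ_{w₁}σ_{w₂} + J₁σ_{w₀}σ_{w₂} + J₂σ_{w₀}σ_{w₁}}`: observables not involving
  `σ_y` have the same expectation under the original system and under the pair system with the bonds
  at `y` switched off and the three bonds `{w₁,w₂}, {w₀,w₂}, {w₀,w₁}` of couplings `J` appended
  (`Fin.append`; the site `y` stays, free).
* `e1_solve_free_row`: if the row `y` of a positive definite matrix `N` is free (`N y k = 0`, `k ≠ y`)
  and `u y = 0`, then `N⁻¹u` agrees off `y` with `(N')⁻¹u'` for the principal submatrix `N'` on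
  `univ ∖ {y}` (uniqueness of the solution of `N β = u`).
-/

namespace Summit.CriticalPhenomena.Ising3DConformalLimit.PrecisionLaplacianMoebiusLimitOfTwoPointLaw

open Literature.Probability.LatticeModels Finset Matrix
open Summit.CriticalPhenomena.Ising3DConformalLimit.Cruxes.InverseMFerromagnet.PartialCovarianceLadder
  (c2_integrate c2_spinProduct_pair)

/-! ## One-spin star–triangle decimation -/

/-- The Hamiltonian of the decimated system: the bonds of `Ky` plus the three extra bonds
`{w₁,w₂}, {w₀,w₂}, {w₀,w₁}` with couplings `J₀, J₁, J₂`. [folklore] -/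
theorem e1_ham_decimate {n m : ℕ} (Ky : Fin m → ℝ) (C : Fin m → Finset (Fin n)) (J : Fin 3 → ℝ)
    (w : Fin 3 → Fin n) (hwd : w 0 ≠ w 1 ∧ w 0 ≠ w 2 ∧ w 1 ≠ w 2) (σ : SpinConfig (Fin n)) :
    gksHamiltonian Finset.univ (Fin.append Ky J)
        (Fin.append C ![{w 1, w 2}, {w 0, w 2}, {w 0, w 1}]) σ
      = gksHamiltonian Finset.univ Ky C σ
        + (J 0 * (spinAt (w 1) σ * spinAt (w 2) σ) + J 1 * (spinAt (w 0) σ * spinAt (w 2) σ)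
          + J 2 * (spinAt (w 0) σ * spinAt (w 1) σ)) := by
  unfold gksHamiltonian
  rw [Fin.sum_univ_add]
  simp only [Fin.append_left, Fin.append_right, Fin.sum_univ_three, Matrix.cons_val_zero,
    Matrix.cons_val_one, Matrix.cons_val_two, Matrix.head_cons, Matrix.tail_cons,
    c2_spinProduct_pair hwd.2.2, c2_spinProduct_pair hwd.2.1, c2_spinProduct_pair hwd.1]

/-- **One-spin decimation, unnormalised.** If `H = Hʸ + σ_y h_y` (`Hʸ = H` with the bonds at `y`
off, `h_y` independent of `σ_y`) and `cosh h_y = e^{c} e^{J₀σ_{w₁}σ_{w₂} + J₁σ_{w₀}σ_{w₂} + J₂σ_{w₀}σ_{w₁}}`,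
then for `F` independent of `σ_y`: `Z⟨F⟩ = e^{c} · Z_ν⟨F⟩_ν` for the decimated system `ν`. [folklore] -/
theorem e1_gksSum_decimate {n m : ℕ} (K Ky : Fin m → ℝ) (C : Fin m → Finset (Fin n)) (y : Fin n)
    (hy : SpinConfig (Fin n) → ℝ) (c : ℝ) (J : Fin 3 → ℝ) (w : Fin 3 → Fin n)
    (hwd : w 0 ≠ w 1 ∧ w 0 ≠ w 2 ∧ w 1 ≠ w 2)
    (hH : ∀ ω, gksHamiltonian Finset.univ K C ω
      = gksHamiltonian Finset.univ Ky C ω + spinAt y ω * hy ω)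
    (hKy : ∀ i, y ∈ C i → Ky i = 0) (hhy : ∀ ω, hy (ω * Pi.mulSingle y (-1)) = hy ω)
    (hcosh : ∀ ω, Real.cosh (hy ω) = Real.exp c * Real.exp (J 0 * (spinAt (w 1) ω * spinAt (w 2) ω)
      + J 1 * (spinAt (w 0) ω * spinAt (w 2) ω) + J 2 * (spinAt (w 0) ω * spinAt (w 1) ω)))
    (F : SpinConfig (Fin n) → ℝ) (hF : ∀ ω, F (ω * Pi.mulSingle y (-1)) = F ω) :
    gksSum Finset.univ K C F
      = Real.exp c * gksSum Finset.univ (Fin.append Ky J)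
          (Fin.append C ![{w 1, w 2}, {w 0, w 2}, {w 0, w 1}]) F := by
  rw [(c2_integrate Finset.univ K Ky C y hy hH (fun i _ => hKy i) hhy F hF).2]
  simp only [gksSum, gksWeight, e1_ham_decimate Ky C J w hwd, hcosh, Real.exp_add, Finset.mul_sum]
  exact Finset.sum_congr rfl fun ω _ => by ring

/-- **One-spin decimation.** With the hypotheses of `e1_gksSum_decimate`, observables independent
of `σ_y` have the same expectation under the original system and under the decimated pair system
`ν` (bonds at `y` off, the star–triangle bonds appended; `y` free). [folklore] -/
theorem e1_decimate {n m : ℕ} (K Ky : Fin m → ℝ) (C : Fin m → Finset (Fin n)) (y : Fin n)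
    (hy : SpinConfig (Fin n) → ℝ) (c : ℝ) (J : Fin 3 → ℝ) (w : Fin 3 → Fin n)
    (hwd : w 0 ≠ w 1 ∧ w 0 ≠ w 2 ∧ w 1 ≠ w 2)
    (hH : ∀ ω, gksHamiltonian Finset.univ K C ω
      = gksHamiltonian Finset.univ Ky C ω + spinAt y ω * hy ω)
    (hKy : ∀ i, y ∈ C i → Ky i = 0) (hhy : ∀ ω, hy (ω * Pi.mulSingle y (-1)) = hy ω)
    (hcosh : ∀ ω, Real.cosh (hy ω) = Real.exp c * Real.exp (J 0 * (spinAt (w 1) ω * spinAt (w 2) ω)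
      + J 1 * (spinAt (w 0) ω * spinAt (w 2) ω) + J 2 * (spinAt (w 0) ω * spinAt (w 1) ω)))
    (F : SpinConfig (Fin n) → ℝ) (hF : ∀ ω, F (ω * Pi.mulSingle y (-1)) = F ω) :
    gksExpect Finset.univ K C F
      = gksExpect Finset.univ (Fin.append Ky J) (Fin.append C ![{w 1, w 2}, {w 0, w 2}, {w 0, w 1}]) F := by
  have hA : Real.exp c ≠ 0 := (Real.exp_pos c).ne'
  unfold gksExpect
  rw [e1_gksSum_decimate K Ky C y hy c J w hwd hH hKy hhy hcosh F hF,
    e1_gksSum_decimate K Ky C y hy c J w hwd hH hKy hhy hcosh (fun _ => 1) (fun _ => rfl)]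
  exact mul_div_mul_left _ _ hA

/-! ## Solving `N β = u` when the row `y` is free -/

/-- **Free row.** Let `N` be positive definite on `Fin n` with the row `y` free (`N y k = 0` for
`k ≠ y`) and let `u y = 0`. Then for `a ≠ y`, `(N⁻¹u)(a) = ((N')⁻¹ u')(a)` where `N'`, `u'` are the
restrictions to `univ ∖ {y}` (pad the restricted solution by `0` at `y` and use uniqueness). [folklore] -/
theorem e1_solve_free_row {n : ℕ} (N : Matrix (Fin n) (Fin n) ℝ) (hN : N.PosDef) (y : Fin n)
    (hfree : ∀ k, k ≠ y → N y k = 0) (u : Fin n → ℝ) (hu : u y = 0)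
    (a : ↥(Finset.univ.erase y)) :
    (N⁻¹.mulVec u) a.1
      = ((N.submatrix (Subtype.val : ↥(Finset.univ.erase y) → Fin n)
          (Subtype.val : ↥(Finset.univ.erase y) → Fin n))⁻¹.mulVec (fun p => u p.1)) a := by
  set T : Finset (Fin n) := Finset.univ.erase y with hT
  set N' : Matrix ↥T ↥T ℝ := N.submatrix (Subtype.val : ↥T → Fin n) (Subtype.val : ↥T → Fin n)
    with hN'
  set β' : ↥T → ℝ := N'⁻¹.mulVec (fun p => u p.1) with hβ'
  have hN'pd : N'.PosDef := hN.submatrix Subtype.val_injective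
  have hNN : N⁻¹ * N = 1 :=
    Matrix.nonsing_inv_mul N ((Matrix.isUnit_iff_isUnit_det N).mp hN.isUnit)
  have hN'N' : N' * N'⁻¹ = 1 :=
    Matrix.mul_nonsing_inv N' ((Matrix.isUnit_iff_isUnit_det N').mp hN'pd.isUnit)
  have hTy : ∀ p : ↥T, p.1 ≠ y := fun p => (Finset.mem_erase.1 p.2).1
  -- the padded vector `b`
  obtain ⟨b, hb⟩ : ∃ b : Fin n → ℝ, ∀ k, b k = if hk : k ∈ T then β' ⟨k, hk⟩ else 0 :=
    ⟨fun k => if hk : k ∈ T then β' ⟨k, hk⟩ else 0, fun _ => rfl⟩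
  have hbT : ∀ p : ↥T, b p.1 = β' p := fun p => by rw [hb, dif_pos p.2]
  have hby : b y = 0 := by rw [hb, dif_neg (by simp [hT])]
  have hsumT : ∀ f : Fin n → ℝ, ∑ k, f k * b k = ∑ p : ↥T, f p.1 * β' p := by
    intro f
    have h1 : ∑ k, f k * b k = ∑ k ∈ T, f k * b k := by
      rw [hT, ← Finset.sum_erase_add _ _ (Finset.mem_univ y), hby, mul_zero, add_zero]
    rw [h1, ← Finset.sum_coe_sort]
    exact Finset.sum_congr rfl fun p _ => by rw [hbT]
  -- `N b = u`
  have hNb : N.mulVec b = u := by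
    funext k
    simp only [Matrix.mulVec, dotProduct]
    rw [hsumT]
    by_cases hk : k = y
    · subst hk
      rw [hu]
      exact Finset.sum_eq_zero fun p _ => by rw [hfree p.1 (hTy p), zero_mul]
    · have hkT : k ∈ T := by simp [hT, hk]
      have h1 : (N'.mulVec β') ⟨k, hkT⟩ = u k := by
        rw [hβ', Matrix.mulVec_mulVec, hN'N', Matrix.one_mulVec]
      rw [← h1]
      simp only [Matrix.mulVec, dotProduct, hN', Matrix.submatrix_apply]
  have hsol : N⁻¹.mulVec u = b := by
    rw [← hNb, Matrix.mulVec_mulVec, hNN, Matrix.one_mulVec]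
  rw [hsol, hbT]

/-- Registered helper `helper_e1_decimate` (representative of this auxiliary file): the one-spin
star–triangle decimation identity `⟨F⟩ = ⟨F⟩_ν` for observables independent of the decimated spin
(`e1_decimate`). [folklore] -/
theorem helper_e1_decimate : ∀ (n m : ℕ) (K Ky : Fin m → ℝ) (C : Fin m → Finset (Fin n)) (y : Fin n) (hy : SpinConfig (Fin n) → ℝ) (c : ℝ) (J : Fin 3 → ℝ) (w : Fin 3 → Fin n), (w 0 ≠ w 1 ∧ w 0 ≠ w 2 ∧ w 1 ≠ w 2) → (∀ ω, gksHamiltonian Finset.univ K C ω = gksHamiltonian Finset.univ Ky C ω + spinAt y ω * hy ω) → (∀ i, y ∈ C i → Ky i = 0) → (∀ ω, hy (ω * Pi.mulSingle y (-1)) = hy ω) → (∀ ω, Real.cosh (hy ω) = Real.exp c * Real.exp (J 0 * (spinAt (w 1) ω * spinAt (w 2) ω) + J 1 * (spinAt (w 0) ω * spinAt (w 2) ω) + J 2 * (spinAt (w 0) ω * spinAt (w 1) ω))) → ∀ F : SpinConfig (Fin n) → ℝ, (∀ ω, F (ω * Pi.mulSingle y (-1)) = F ω) → gksExpect Finset.univ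 K C F = gksExpect Finset.univ (Fin.append Ky J) (Fin.append C ![{w 1, w 2}, {w 0, w 2}, {w 0, w 1}]) F :=
  fun _ _ K Ky C y hy c J w hwd hH hKy hhy hcosh F hF =>
    e1_decimate K Ky C y hy c J w hwd hH hKy hhy hcosh F hF

end Summit.CriticalPhenomena.Ising3DConformalLimit.PrecisionLaplacianMoebiusLimitOfTwoPointLaw
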